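import Summits.ValiantsHypothesis.ValiantsHypothesis.Theorems.LacunarySymmetroidMatrixDescartesCensusBoundaryLift

/-!
# `MatrixDescartes` census — the HIERARCHICAL LIFTING LEMMA (part 3): the TOP stratum `F₅(d)`

HONEST FRAMING.  Object-search cell `pub-symmetroid`, crux `Theses.LacunarySymmetroid.MatrixDescartes`
(stmt-ValiantsHypothesis-18050); this file is a HELPER of that item with no closure claim.  Mirror image (under
`t ↦ 1/t`, `Sᵢ ↦ S₅₋ᵢ`) of part 2's `twenty_of_boundary_seventeen`, proved DIRECTLY (no appeal to the census mirror
lemma, so that the file depends only on parts 1–2): on the TOP boundary stratum `F₅(d)` of the V = 20 programme for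
`DoorA26 = PosRootLawAt 2 6 19` (OPEN, never asserted) — `S₅ = (S₅)₀₀·e₁e₁ᵀ` with `(S₅)₀₀ ≠ 0`, `(S₄)₁₁ = (S₃)₁₁ = 0`, side
condition `2 d₄ < d₃ + d₅` — a determinant with an alternation chain of `18` positive points lifts, by switching on the
three vanishing TOP coefficients (orders `d₃ + d₅ < d₄ + d₅ < 2d₅`) with hierarchically small perturbations along
`e₂e₂ᵀ`, to a real symmetric pencil ON THE SAME SUPPORT with `≥ 20` distinct positive roots
(`twenty_of_top_boundary_seventeen`).  NOTHING here asserts that such boundary forms exist; nothing bounds `ζ`; nothing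
bears on `MatrixDescartes` or on `VP ≠ VNP`.  (Theory seat's note RESIDUE-READING §2(g)/(k): the atlas's type-I cells
come in `F₀`/`F₅` mirror pairs, e.g. `(0,2,3,8,18,32)+ F₅`, `(0,11,20,24,25,27)+ F₅`.)

Contents (all PROVED): `altChain_eval_ne_zero`; `altChain_lift_step_top` (ONE LIFTING STEP AT THE TOP: `g` with no
coefficient from order `e ≥ 1` on and a chain of length `N + 1`, `r` with top coefficient `r_e ≠ 0` at order `e`; for
small `η` with `sign (η r_e) = −sign g(a_N)` the polynomial `g + η r` — degree `e`, leading coefficient `η r_e`, so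
`(η r_e)·(g + η r) → +∞` — has a chain of length `N + 2` with ONE new point beyond `a_N`); `altChain_lift_three_top`;
`m00_coeff_top` / `m00_coeff_eq_zero_of_lt` / `coeff_X_pow_mul_m00_top` / `coeff_X_pow_mul_m00_above`;
`boundaryF5_coeff_eq_zero` (on `F₅(d)` every coefficient above `max(d₂ + d₅, 2d₄)` vanishes, by degree counting
`deg A₀₀ ≤ d₅`, `deg A₁₁ ≤ d₂`, `deg A₀₁ ≤ d₄`); `lift_three_top_on_support`; `twenty_of_top_boundary_seventeen`.

[folklore] Elementary; no citation exists or is needed.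
-/

-- `Summit.ValiantsHypothesis.ValiantsHypothesis.…` repeats a component by the D-0017 layout
-- (single-conjunct summit), which the `dupNamespace` linter flags; the name is mandated.
set_option linter.dupNamespace false

open Polynomial Finset Filter
open scoped BigOperators Polynomial Topology

namespace Summit.ValiantsHypothesis.ValiantsHypothesis.Theorems.LacunarySymmetroidMatrixDescartes.Census


/-- every point of an alternation chain is a non-root. [folklore] -/
theorem altChain_eval_ne_zero {p : ℝ[X]} {N : ℕ} {s : ℝ} {a : Fin (N + 1) → ℝ} (h : AltChain p N s a) (i : Fin (N + 1)) :
    p.eval (a i) ≠ 0 := by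
  obtain ⟨-, -, halt, hanc⟩ := h
  rcases Fin.eq_zero_or_eq_succ i with h0 | ⟨j, rfl⟩
  · subst h0
    intro h0; rw [h0, mul_zero] at hanc; exact lt_irrefl _ hanc
  · intro h0; have := halt j; rw [h0, mul_zero] at this; exact lt_irrefl _ this

/-- **ONE LIFTING STEP AT THE TOP.**  Let `g` have all coefficients of order `≥ e` zero (`e ≥ 1`) and carry an alternation
chain of length `N + 1`; let `r` have order-`e` coefficient `r_e ≠ 0` and nothing above.  For every non-zero `η` small
enough with `sign (η r_e) = −sign g(a_N)`, the polynomial `g + η r` (degree exactly `e`, leading coefficient `η r_e`)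
carries an alternation chain of length `N + 2`: the old points and ONE new point beyond `a_N`. [folklore] -/
theorem altChain_lift_step_top (g r : ℝ[X]) (e : ℕ) (he : 0 < e) (hg : ∀ k, e ≤ k → g.coeff k = 0)
    (hr : ∀ k, e < k → r.coeff k = 0) (hre : r.coeff e ≠ 0)
    (N : ℕ) (s : ℝ) (a : Fin (N + 1) → ℝ) (hchain : AltChain g N s a) :
    ∃ η₀ : ℝ, 0 < η₀ ∧ ∀ η : ℝ, η ≠ 0 → |η| < η₀ → η * r.coeff e * g.eval (a (Fin.last N)) < 0 →
      ∃ a' : Fin (N + 2) → ℝ, a (Fin.last N) < a' (Fin.last (N + 1)) ∧ (∀ i : Fin (N + 1), a' i.castSucc = a i) ∧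
        AltChain (g + C η * r) (N + 1) s a' := by
  obtain ⟨hmono, ha0, halt, hanc⟩ := hchain
  have hgnz : ∀ i, g.eval (a i) ≠ 0 := by
    intro i
    rcases Fin.eq_zero_or_eq_succ i with h | ⟨j, rfl⟩
    · subst h
      intro h0; rw [h0, mul_zero] at hanc; exact lt_irrefl _ hanc
    · intro h0; have := halt j; rw [h0, mul_zero] at this; exact lt_irrefl _ this
  have hne : (Finset.univ : Finset (Fin (N + 1))).Nonempty := ⟨0, mem_univ _⟩
  set μ : ℝ := Finset.univ.inf' hne (fun i => |g.eval (a i)|) with hμ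
  set S : ℝ := Finset.univ.sup' hne (fun i => |r.eval (a i)|) with hS
  have hμpos : 0 < μ := by
    rw [hμ, Finset.lt_inf'_iff]; intro i _; exact abs_pos.mpr (hgnz i)
  have hμle : ∀ i, μ ≤ |g.eval (a i)| := fun i => Finset.inf'_le _ (mem_univ i)
  have hSge : ∀ i, |r.eval (a i)| ≤ S := fun i => Finset.le_sup' (fun i => |r.eval (a i)|) (mem_univ i)
  have hS0 : 0 ≤ S := (abs_nonneg _).trans (hSge 0)
  refine ⟨μ / (S + 1), div_pos hμpos (by linarith), ?_⟩
  intro η hη hsmall hsign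
  set f : ℝ[X] := g + C η * r with hf
  -- (1) old points keep their signs
  have hpert : ∀ i, |η * r.eval (a i)| < |g.eval (a i)| := by
    intro i
    have h1 : |η * r.eval (a i)| = |η| * |r.eval (a i)| := abs_mul _ _
    have h2 : |η| * |r.eval (a i)| ≤ |η| * S := mul_le_mul_of_nonneg_left (hSge i) (abs_nonneg _)
    have h3 : |η| * S ≤ μ / (S + 1) * S := mul_le_mul_of_nonneg_right hsmall.le hS0
    have h4 : μ / (S + 1) * S < μ := by
      rw [div_mul_eq_mul_div, div_lt_iff₀ (by linarith)]
      nlinarith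
    linarith [hμle i]
  have hkeep : ∀ i, 0 < g.eval (a i) * f.eval (a i) := by
    intro i
    have h1 := hpert i
    have h2 : -(|η * r.eval (a i)| * |g.eval (a i)|) ≤ (η * r.eval (a i)) * g.eval (a i) := by
      rw [← abs_mul]; exact neg_abs_le _
    have h3 : 0 < |g.eval (a i)| * (|g.eval (a i)| - |η * r.eval (a i)|) :=
      mul_pos (abs_pos.mpr (hgnz i)) (sub_pos.mpr h1)
    have h4 : g.eval (a i) * f.eval (a i) = g.eval (a i) ^ 2 + (η * r.eval (a i)) * g.eval (a i) := by
      rw [hf]; simp only [eval_add, eval_mul, eval_C]; ring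
    rw [h4]; nlinarith [sq_abs (g.eval (a i))]
  -- (2) the new point beyond `a_N`: `c · f → +∞`
  set c : ℝ := η * r.coeff e with hc
  have hcne : c ≠ 0 := mul_ne_zero hη hre
  have hfe : f.coeff e = c := by
    rw [hf, coeff_add, coeff_C_mul, hg e le_rfl, zero_add]
  have hfdeg : f.natDegree = e := by
    apply le_antisymm
    · rw [natDegree_le_iff_coeff_eq_zero]
      intro k hk
      have hk' : e < k := by exact_mod_cast hk
      rw [hf, coeff_add, coeff_C_mul, hg k hk'.le, hr k hk', mul_zero, add_zero]
    · exact le_natDegree_of_ne_zero (by rw [hfe]; exact hcne)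
  have hflead : f.leadingCoeff = c := by rw [leadingCoeff, hfdeg, hfe]
  set F : ℝ[X] := C c * f with hF
  have hFdeg : 0 < F.degree := by
    rw [hF, degree_C_mul hcne]
    have : f.degree = e := by
      rw [degree_eq_natDegree (by intro h0; rw [h0, natDegree_zero] at hfdeg; omega), hfdeg]
    rw [this]; exact_mod_cast he
  have hFlead : 0 ≤ F.leadingCoeff := by
    rw [hF, leadingCoeff_mul, leadingCoeff_C, hflead]; exact mul_self_nonneg c
  have hFtop : Tendsto (fun x => F.eval x) atTop atTop := tendsto_atTop_of_leadingCoeff_nonneg F hFdeg hFlead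
  obtain ⟨t₁, ht₁gt, ht₁pos⟩ : ∃ t₁, a (Fin.last N) < t₁ ∧ 0 < F.eval t₁ := by
    have h1 := hFtop.eventually_gt_atTop 0
    have h2 := eventually_gt_atTop (a (Fin.last N))
    obtain ⟨t, ht⟩ := (h2.and h1).exists
    exact ⟨t, ht.1, ht.2⟩
  have hnew : 0 < c * f.eval t₁ := by
    have : F.eval t₁ = c * f.eval t₁ := by rw [hF, eval_mul, eval_C]
    rw [← this]; exact ht₁pos
  -- (3) assemble with `Fin.snoc`
  refine ⟨Fin.snoc a t₁, by simpa using ht₁gt, fun i => by simp, ?_, by simpa using ha0, ?_, ?_⟩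
  · rw [Fin.strictMono_iff_lt_succ]
    intro i
    refine Fin.lastCases ?_ (fun j => ?_) i
    · simp only [Fin.snoc_last, Fin.succ_last, Fin.snoc_castSucc]
      exact ht₁gt
    · have h1 : (j.castSucc).succ = j.succ.castSucc := Fin.succ_castSucc j
      rw [h1, Fin.snoc_castSucc, Fin.snoc_castSucc]
      exact hmono (by exact Fin.castSucc_lt_succ)
  · intro i
    refine Fin.lastCases ?_ (fun j => ?_) i
    · simp only [Fin.snoc_last, Fin.succ_last, Fin.snoc_castSucc]
      exact mul_neg_of_sign_transfer (hkeep (Fin.last N)) hnew (by rw [hc]; linarith [hsign])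
    · have h1 : (j.castSucc).succ = j.succ.castSucc := Fin.succ_castSucc j
      rw [h1, Fin.snoc_castSucc, Fin.snoc_castSucc]
      exact mul_neg_of_sign_transfer (hkeep j.castSucc) (hkeep j.succ) (halt j)
  · have h0 : (Fin.snoc a t₁ : Fin (N + 2) → ℝ) 0 = a 0 := by
      rw [← Fin.castSucc_zero, Fin.snoc_castSucc]
    rw [h0]
    have := hkeep 0
    by_contra hcon
    push Not at hcon
    nlinarith [mul_pos hanc this, sq_nonneg (g.eval (a 0))]


/-- **THREE LIFTING STEPS AT THE TOP**: switching on three terms of orders `e₃ < e₄ < e₅` above a polynomial `g` whose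
coefficients vanish from order `e₃` on turns an alternation chain of length `N + 1` into one of length `N + 4`. [folklore] -/
theorem altChain_lift_three_top (g r₃ r₄ r₅ : ℝ[X]) (e₃ e₄ e₅ : ℕ) (he : 0 < e₃) (h34 : e₃ < e₄) (h45 : e₄ < e₅)
    (hg : ∀ k, e₃ ≤ k → g.coeff k = 0)
    (hr₃ : ∀ k, e₃ < k → r₃.coeff k = 0) (hr₃e : r₃.coeff e₃ ≠ 0)
    (hr₄ : ∀ k, e₄ < k → r₄.coeff k = 0) (hr₄e : r₄.coeff e₄ ≠ 0)
    (hr₅ : ∀ k, e₅ < k → r₅.coeff k = 0) (hr₅e : r₅.coeff e₅ ≠ 0)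
    (N : ℕ) (s : ℝ) (a : Fin (N + 1) → ℝ) (hchain : AltChain g N s a) :
    ∃ η₃ η₄ η₅ : ℝ, ∃ a' : Fin (N + 4) → ℝ,
      AltChain (g + C η₃ * r₃ + C η₄ * r₄ + C η₅ * r₅) (N + 3) s a' := by
  -- step 1 (order e₃)
  obtain ⟨b₃, hb₃, H₃⟩ := altChain_lift_step_top g r₃ e₃ he hg hr₃ hr₃e N s a hchain
  obtain ⟨η₃, hη₃, hη₃b, hη₃s⟩ := exists_small_of_sign b₃ _ (r₃.coeff e₃) hb₃
    (altChain_eval_ne_zero hchain (Fin.last N)) hr₃e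
  obtain ⟨a₃, -, -, hchain₃⟩ := H₃ η₃ hη₃ hη₃b hη₃s
  set g₃ := g + C η₃ * r₃ with hg₃
  have hg₃c : ∀ k, e₄ ≤ k → g₃.coeff k = 0 := by
    intro k hk
    rw [hg₃, coeff_add, coeff_C_mul, hg k (by omega), hr₃ k (by omega), mul_zero, add_zero]
  -- step 2 (order e₄)
  obtain ⟨b₄, hb₄, H₄⟩ := altChain_lift_step_top g₃ r₄ e₄ (by omega) hg₃c hr₄ hr₄e (N + 1) s a₃ hchain₃
  obtain ⟨η₄, hη₄, hη₄b, hη₄s⟩ := exists_small_of_sign b₄ _ (r₄.coeff e₄) hb₄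
    (altChain_eval_ne_zero hchain₃ (Fin.last (N + 1))) hr₄e
  obtain ⟨a₄, -, -, hchain₄⟩ := H₄ η₄ hη₄ hη₄b hη₄s
  set g₄ := g₃ + C η₄ * r₄ with hg₄
  have hg₄c : ∀ k, e₅ ≤ k → g₄.coeff k = 0 := by
    intro k hk
    rw [hg₄, coeff_add, coeff_C_mul, hg₃c k (by omega), hr₄ k (by omega), mul_zero, add_zero]
  -- step 3 (order e₅)
  obtain ⟨b₅, hb₅, H₅⟩ := altChain_lift_step_top g₄ r₅ e₅ (by omega) hg₄c hr₅ hr₅e (N + 2) s a₄ hchain₄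
  obtain ⟨η₅, hη₅, hη₅b, hη₅s⟩ := exists_small_of_sign b₅ _ (r₅.coeff e₅) hb₅
    (altChain_eval_ne_zero hchain₄ (Fin.last (N + 2))) hr₅e
  obtain ⟨a₅, -, -, hchain₅⟩ := H₅ η₅ hη₅ hη₅b hη₅s
  exact ⟨η₃, η₄, η₅, a₅, hchain₅⟩

/-! ## The top boundary stratum `F₅(d)` -/

/-- on sorted exponents the top coefficient of `m₀₀` is `(S₅)₀₀` … [folklore] -/
theorem m00_coeff_top (d : Fin 6 → ℕ) (hd : StrictMono d) (S : Fin 6 → Matrix (Fin 2) (Fin 2) ℝ) :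
    (m00 d S).coeff (d 5) = (S 5) 0 0 := by
  unfold m00
  rw [finsetSum_coeff, Finset.sum_eq_single (5 : Fin 6)]
  · simp
  · intro l _ hl
    have hdl : d l < d 5 := hd (lt_of_le_of_ne (Fin.le_last l) hl)
    rw [coeff_X_pow_mul', if_pos hdl.le, coeff_C, if_neg (Nat.sub_ne_zero_of_lt hdl)]
  · intro h; exact absurd (mem_univ _) h

/-- … and nothing lies above it. [folklore] -/
theorem m00_coeff_eq_zero_of_lt (d : Fin 6 → ℕ) (hd : StrictMono d) (S : Fin 6 → Matrix (Fin 2) (Fin 2) ℝ)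
    (k : ℕ) (hk : d 5 < k) : (m00 d S).coeff k = 0 := by
  unfold m00
  rw [finsetSum_coeff]
  apply Finset.sum_eq_zero
  intro l _
  have hdl : d l < k := lt_of_le_of_lt (hd.monotone (Fin.le_last l)) hk
  rw [coeff_X_pow_mul']
  simp [hdl.le, coeff_C, Nat.sub_ne_zero_of_lt hdl]

/-- `X^n · m₀₀` has order-`(n + d₅)` coefficient `(S₅)₀₀` and nothing above. [folklore] -/
theorem coeff_X_pow_mul_m00_top (d : Fin 6 → ℕ) (hd : StrictMono d) (S : Fin 6 → Matrix (Fin 2) (Fin 2) ℝ) (n : ℕ) :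
    ((X : ℝ[X]) ^ n * m00 d S).coeff (n + d 5) = (S 5) 0 0 := by
  rw [coeff_X_pow_mul']; simp [m00_coeff_top d hd S]

/-- `X^n · m₀₀` has no coefficient above order `n + d₅`. [folklore] -/
theorem coeff_X_pow_mul_m00_above (d : Fin 6 → ℕ) (hd : StrictMono d) (S : Fin 6 → Matrix (Fin 2) (Fin 2) ℝ)
    (n k : ℕ) (hk : n + d 5 < k) : ((X : ℝ[X]) ^ n * m00 d S).coeff k = 0 := by
  rw [coeff_X_pow_mul']
  simp only [show n ≤ k by omega, if_true]
  exact m00_coeff_eq_zero_of_lt d hd S _ (by omega)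

/-- **TOP BOUNDARY STRATUM `F₅(d)` ⇒ high coefficients vanish.**  If `S₅ = (S₅)₀₀·e₁e₁ᵀ` (`(S₅)₀₁ = (S₅)₁₁ = 0`) and
`(S₄)₁₁ = (S₃)₁₁ = 0`, then every coefficient of the determinant of order `> max(d₂ + d₅, 2 d₄)` vanishes. [folklore] -/
theorem boundaryF5_coeff_eq_zero (d : Fin 6 → ℕ) (hd : StrictMono d)
    (S : Fin 6 → Matrix (Fin 2) (Fin 2) ℝ) (hS : ∀ l, (S l).IsSymm)
    (h01 : (S 5) 0 1 = 0) (h11 : ∀ l : Fin 6, 3 ≤ l → (S l) 1 1 = 0)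
    (k : ℕ) (hk2 : d 2 + d 5 < k) (hk4 : 2 * d 4 < k) : (pencil2 d S).det.coeff k = 0 := by
  have hterm : ∀ (c : ℝ) (n : ℕ), ((X : ℝ[X]) ^ n * C c).natDegree ≤ n := fun c n =>
    (natDegree_mul_le).trans (by simp)
  have hA00 : (pencil2 d S 0 0).natDegree ≤ d 5 := by
    rw [pencil2_apply]
    apply natDegree_sum_le_of_forall_le
    intro l _
    exact (hterm _ _).trans (hd.monotone (Fin.le_last l))
  have hA11 : (pencil2 d S 1 1).natDegree ≤ d 2 := by
    rw [pencil2_apply]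
    apply natDegree_sum_le_of_forall_le
    intro l _
    by_cases hl : 3 ≤ l
    · rw [h11 l hl, map_zero, mul_zero, natDegree_zero]; exact Nat.zero_le _
    · exact (hterm _ _).trans (hd.monotone (by
        rcases l with ⟨l, hl'⟩
        simp only [Fin.le_def] at hl ⊢
        simp at hl ⊢; omega))
  have hA01 : (pencil2 d S 0 1).natDegree ≤ d 4 := by
    rw [pencil2_apply]
    apply natDegree_sum_le_of_forall_le
    intro l _
    by_cases hl : l = 5
    · subst hl; rw [h01, map_zero, mul_zero, natDegree_zero]; exact Nat.zero_le _
    · exact (hterm _ _).trans (hd.monotone (by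
        rcases l with ⟨l, hl'⟩
        simp only [Fin.le_def]
        have : l ≠ 5 := fun h => hl (by ext; simpa using h)
        simp; omega))
  have hA10 : (pencil2 d S 1 0).natDegree ≤ d 4 := by
    have : pencil2 d S 1 0 = pencil2 d S 0 1 := by
      rw [pencil2_apply, pencil2_apply]
      apply Finset.sum_congr rfl; intro l _
      rw [show (S l) 1 0 = (S l) 0 1 from by
        have := (hS l).apply 0 1; exact this]
    rw [this]; exact hA01
  rw [Matrix.det_fin_two, coeff_sub]
  have h1 : ((pencil2 d S 0 0) * (pencil2 d S 1 1)).coeff k = 0 :=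
    coeff_eq_zero_of_natDegree_lt (lt_of_le_of_lt natDegree_mul_le (by omega))
  have h2 : ((pencil2 d S 0 1) * (pencil2 d S 1 0)).coeff k = 0 :=
    coeff_eq_zero_of_natDegree_lt (lt_of_le_of_lt natDegree_mul_le (by omega))
  rw [h1, h2, sub_zero]

/-- **TOP LIFTING ON A SUPPORT (general chain length).** [folklore] -/
theorem lift_three_top_on_support (d : Fin 6 → ℕ) (hd : StrictMono d)
    (S : Fin 6 → Matrix (Fin 2) (Fin 2) ℝ) (h55 : (S 5) 0 0 ≠ 0)
    (hhigh : ∀ k, d 3 + d 5 ≤ k → (pencil2 d S).det.coeff k = 0)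
    (N : ℕ) (s : ℝ) (a : Fin (N + 1) → ℝ) (hchain : AltChain (pencil2 d S).det N s a) :
    ∃ ψ : Fin 6 → ℝ, N + 3 ≤ ((pencil2 d (fun l => S l + ψ l • E22)).det.roots.toFinset.filter
      (fun t => 0 < t)).card := by
  have h0 : 0 < d 3 := lt_of_le_of_lt (Nat.zero_le _) (hd (show (0 : Fin 6) < 3 by decide))
  have h34 : d 3 < d 4 := hd (by decide)
  have h45 : d 4 < d 5 := hd (by decide)
  obtain ⟨η₃, η₄, η₅, a', hch⟩ := altChain_lift_three_top (pencil2 d S).det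
    (X ^ d 3 * m00 d S) (X ^ d 4 * m00 d S) (X ^ d 5 * m00 d S) (d 3 + d 5) (d 4 + d 5) (d 5 + d 5)
    (by omega) (by omega) (by omega) hhigh
    (fun k hk => coeff_X_pow_mul_m00_above d hd S _ k hk) (by rw [coeff_X_pow_mul_m00_top d hd]; exact h55)
    (fun k hk => coeff_X_pow_mul_m00_above d hd S _ k hk) (by rw [coeff_X_pow_mul_m00_top d hd]; exact h55)
    (fun k hk => coeff_X_pow_mul_m00_above d hd S _ k hk) (by rw [coeff_X_pow_mul_m00_top d hd]; exact h55)
    N s a hchain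
  refine ⟨![0, 0, 0, η₃, η₄, η₅], ?_⟩
  have hdet : (pencil2 d (fun l => S l + (![0, 0, 0, η₃, η₄, η₅] : Fin 6 → ℝ) l • E22)).det
      = (pencil2 d S).det + C η₃ * (X ^ d 3 * m00 d S) + C η₄ * (X ^ d 4 * m00 d S)
        + C η₅ * (X ^ d 5 * m00 d S) := by
    rw [det_pencil2_perturb]
    have hΦ : (∑ l, (X : ℝ[X]) ^ d l * C ((![0, 0, 0, η₃, η₄, η₅] : Fin 6 → ℝ) l))
        = X ^ d 3 * C η₃ + X ^ d 4 * C η₄ + X ^ d 5 * C η₅ := by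
      simp [Fin.sum_univ_six]
    rw [hΦ]; unfold m00; ring
  rw [hdet]
  exact le_card_posRoots_of_altChain hch

/-- **RESIDUE-READING §2(g), TOP form — a boundary seventeen on `F₅(d)` lifts to a twenty on the same support.**  Let
`d₀ < d₁ < ⋯ < d₅` and `2 d₄ < d₃ + d₅`, and let `S` be real symmetric letters on the TOP boundary stratum
`F₅(d)`: `S₅ = (S₅)₀₀·e₁e₁ᵀ` with `(S₅)₀₀ ≠ 0`, `(S₄)₁₁ = (S₃)₁₁ = 0`.  If the determinant of the pencil carries an
alternation chain of `18` positive points, some real symmetric `2 × 2` pencil on the SAME exponents has at least `20`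
distinct positive roots.  (Mirror image of `twenty_of_boundary_seventeen` under `t ↦ 1/t`, proved directly.)  Nothing
is asserted about the existence of such forms. [folklore] -/
theorem twenty_of_top_boundary_seventeen (d : Fin 6 → ℕ) (hd : StrictMono d)
    (h4 : 2 * d 4 < d 3 + d 5)
    (S : Fin 6 → Matrix (Fin 2) (Fin 2) ℝ) (hS : ∀ l, (S l).IsSymm)
    (h55 : (S 5) 0 0 ≠ 0) (h01 : (S 5) 0 1 = 0) (h11 : ∀ l : Fin 6, 3 ≤ l → (S l) 1 1 = 0)
    (s : ℝ) (a : Fin 18 → ℝ)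
    (hchain : AltChain (∑ l, (X : ℝ[X]) ^ d l • (S l).map C).det 17 s a) :
    ∃ S' : Fin 6 → Matrix (Fin 2) (Fin 2) ℝ, (∀ l, (S' l).IsSymm) ∧
      20 ≤ ((∑ l, (X : ℝ[X]) ^ d l • (S' l).map C).det.roots.toFinset.filter (fun t => 0 < t)).card := by
  have h23 : d 2 < d 3 := hd (by decide)
  have hhigh : ∀ k, d 3 + d 5 ≤ k → (pencil2 d S).det.coeff k = 0 := by
    intro k hk
    exact boundaryF5_coeff_eq_zero d hd S hS h01 h11 k (by omega) (by omega)
  obtain ⟨ψ, hψ⟩ := lift_three_top_on_support d hd S h55 hhigh 17 s a hchain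
  exact ⟨fun l => S l + ψ l • E22, pencil2_perturb_isSymm S hS ψ, hψ⟩

end Summit.ValiantsHypothesis.ValiantsHypothesis.Theorems.LacunarySymmetroidMatrixDescartes.Census
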